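import Mathlib
import Summits.NavierStokesRegularity.NavierStokesRegularity.Theorems.WakeRatchetTailRatchetDyadicPositivity
import HarnessLib

/-!
# `WakeRatchet.TailRatchet` (stmt-NavierStokesRegularity-21808), door D4′ — Cauchy side:
# regular solutions of the dyadic lattice are `ℓ^∞`-valued integral curves; UNIQUENESS

Def-free support lemmas for the aside crux `TailRatchet` (route `WakeRatchet`).  MODEL lattice ODEs only
(the scalar dyadic chain `Ẋₙ = Λⁿ⁻¹ Xₙ₋₁² − Λⁿ Xₙ Xₙ₊₁` of Tao 2016 §1.2 / §4, `m = 1`, any real `Λ > 0`);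
nothing in this file is a statement about the Navier–Stokes equations; stmt-21808 is neither proved nor
refuted here and no stub of skeleton d00b85951d7c is closed.

WHY.  The Cauchy side of door D4′ (census of stmt-21808) needs a MAXIMAL regular non-negative solution;
maximality is built from local existence (`…DyadicLocalExistence`) and UNIQUENESS.  The a-priori objects of
the door (`typeI_dyadic`, `dyadic_nonneg`, …) are stated for shell-wise («coordinatewise») solutions
`X : ℤ → ℝ → ℝ` that are REGULAR (`sup_n Λⁿ|Xₙ| < ∞` on the interval).  This file shows that such a
coordinatewise regular solution, conjugated to `Yₙ = ΛⁿXₙ` and clamped outside the interval, IS an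
integral curve in the Banach space `ℓ^∞(ℤ) = (ℤ →ᵇ ℝ)` of the bounded-coefficient field
`Yₙ ↦ ΛYₙ₋₁² − Λ⁻¹YₙYₙ₊₁` (norm-differentiable, not just coordinatewise: the coordinate derivatives are
Lipschitz in time UNIFORMLY in `n`), and deduces uniqueness of regular solutions from Mathlib's
Gronwall-based `ODE_solution_unique_of_mem_Ioo`.

CONTENTS (all def-free):
* `conjField_bound`, `conjField_lipschitz` — the conjugated field is bounded by `(Λ+Λ⁻¹)‖Y‖²`
  coordinatewise and `2(Λ+Λ⁻¹)ρ`-Lipschitz on the ball `‖Y‖ ≤ ρ` of `ℓ^∞(ℤ)`.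
* `hasDerivAt_of_coord` — a curve `f : ℝ → (ℤ →ᵇ ℝ)` whose coordinates are differentiable near `t`
  with coordinate derivatives `D τ n` obeying `|D τ n − D t n| ≤ M|τ − t|` uniformly in `n` is
  norm-differentiable at `t` with derivative `D t`.
* `dyadic_regular_lipschitz` — a regular solution is Lipschitz in time uniformly in the shell:
  `|ΛⁿXₙ(τ) − ΛⁿXₙ(t)| ≤ (Λ+Λ⁻¹)B²|τ − t|`.
* `dyadic_unique` — UNIQUENESS: two solutions of the lattice on `(a, T)` (all shells), both regular
  (`Λⁿ|Xₙ| ≤ B`), agreeing at one instant `t₀ ∈ (a, T)`, agree on `(a, T)`.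

HONEST FRAMING: standard ODE theory in a Banach space applied to a MODEL lattice; the maximal solution /
blow-up alternative and the inputs (M), (D), (Q) of door D4′ are NOT addressed here; rung 0.
-/

noncomputable section

set_option linter.dupNamespace false

namespace Summit.NavierStokesRegularity.NavierStokesRegularity.Theorems

namespace WakeRatchetDyadicCauchy

open Set Filter Topology Metric Asymptotics BoundedContinuousFunction
open scoped NNReal

/-! ## The conjugated field on `ℓ^∞(ℤ)` -/

/-- Coordinates of a bounded function are bounded by its norm. [folklore] -/
theorem abs_coe_le_norm (Y : ℤ →ᵇ ℝ) (k : ℤ) : |Y k| ≤ ‖Y‖ := by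
  simpa only [Real.norm_eq_abs] using Y.norm_coe_le_norm k

/-- **Bound of the conjugated field**: `|ΛYₙ₋₁² − Λ⁻¹YₙYₙ₊₁| ≤ (Λ+Λ⁻¹)‖Y‖²`.
[cite: Tao2016AveragedNS, §1.2 (dyadic model), §4 Lemma 4.1 (4.8) with `m = 1`; elementary] -/
theorem conjField_bound {Λ : ℝ} (hΛ : 0 < Λ) (Y : ℤ →ᵇ ℝ) (n : ℤ) :
    ‖Λ * Y (n - 1) ^ 2 - Λ⁻¹ * Y n * Y (n + 1)‖ ≤ (Λ + Λ⁻¹) * ‖Y‖ ^ 2 := by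
  have hΛi : 0 < Λ⁻¹ := inv_pos.2 hΛ
  rw [Real.norm_eq_abs]
  have h1 := abs_coe_le_norm Y (n - 1)
  have h2 := abs_coe_le_norm Y n
  have h3 := abs_coe_le_norm Y (n + 1)
  have hY := norm_nonneg Y
  have e1 : |Λ * Y (n - 1) ^ 2| ≤ Λ * ‖Y‖ ^ 2 := by
    rw [abs_mul, abs_of_pos hΛ, abs_pow]
    exact mul_le_mul_of_nonneg_left (pow_le_pow_left₀ (abs_nonneg _) h1 2) hΛ.le
  have e2 : |Λ⁻¹ * Y n * Y (n + 1)| ≤ Λ⁻¹ * ‖Y‖ ^ 2 := by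
    rw [abs_mul, abs_mul, abs_of_pos hΛi, mul_assoc, sq]
    exact mul_le_mul_of_nonneg_left (mul_le_mul h2 h3 (abs_nonneg _) hY) hΛi.le
  calc |Λ * Y (n - 1) ^ 2 - Λ⁻¹ * Y n * Y (n + 1)|
      ≤ |Λ * Y (n - 1) ^ 2| + |Λ⁻¹ * Y n * Y (n + 1)| := abs_sub _ _
    _ ≤ Λ * ‖Y‖ ^ 2 + Λ⁻¹ * ‖Y‖ ^ 2 := add_le_add e1 e2
    _ = (Λ + Λ⁻¹) * ‖Y‖ ^ 2 := by ring

/-- **Norm bound of the conjugated field on a ball**: `‖Y‖ ≤ ρ ⇒ ‖F(Y)‖ ≤ (Λ+Λ⁻¹)ρ²`.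
[cite: Tao2016AveragedNS, §1.2, §4 Lemma 4.1 (4.8) with `m = 1`; elementary] -/
theorem conjField_norm_le {Λ : ℝ} (hΛ : 0 < Λ) {ρ : ℝ} (Y : ℤ →ᵇ ℝ) (hY : ‖Y‖ ≤ ρ) :
    ‖ofNormedAddCommGroupDiscrete (fun n => Λ * Y (n - 1) ^ 2 - Λ⁻¹ * Y n * Y (n + 1))
        ((Λ + Λ⁻¹) * ‖Y‖ ^ 2) (conjField_bound hΛ Y)‖ ≤ (Λ + Λ⁻¹) * ρ ^ 2 := by
  have hC : 0 < Λ + Λ⁻¹ := by positivity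
  have hρ : 0 ≤ ρ := (norm_nonneg Y).trans hY
  refine (norm_le (by positivity)).2 fun n => ?_
  refine (conjField_bound hΛ Y n).trans ?_
  exact mul_le_mul_of_nonneg_left (pow_le_pow_left₀ (norm_nonneg _) hY 2) hC.le

/-- **Lipschitz bound of the conjugated field on a ball** of `ℓ^∞(ℤ)`: on `‖Y‖ ≤ ρ` the field
`Yₙ ↦ ΛYₙ₋₁² − Λ⁻¹YₙYₙ₊₁` is `2(Λ+Λ⁻¹)ρ`-Lipschitz.
[cite: Tao2016AveragedNS, §1.2, §4 Lemma 4.1 (4.8) with `m = 1`; elementary] -/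
theorem conjField_lipschitz {Λ : ℝ} (hΛ : 0 < Λ) {ρ : ℝ} (hρ : 0 ≤ ρ) :
    LipschitzOnWith (Real.toNNReal (2 * (Λ + Λ⁻¹) * ρ))
      (fun Y : ℤ →ᵇ ℝ => ofNormedAddCommGroupDiscrete
        (fun n => Λ * Y (n - 1) ^ 2 - Λ⁻¹ * Y n * Y (n + 1)) ((Λ + Λ⁻¹) * ‖Y‖ ^ 2)
        (conjField_bound hΛ Y))
      (closedBall (0 : ℤ →ᵇ ℝ) ρ) := by
  have hΛi : 0 < Λ⁻¹ := inv_pos.2 hΛ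
  refine LipschitzOnWith.of_dist_le_mul fun Y hY Z hZ => ?_
  rw [mem_closedBall, dist_zero_right] at hY hZ
  rw [dist_eq_norm, dist_eq_norm]
  rw [Real.coe_toNNReal _ (by positivity)]
  have hd : ∀ k : ℤ, |Y k - Z k| ≤ ‖Y - Z‖ := fun k => by
    simpa only [BoundedContinuousFunction.coe_sub, Pi.sub_apply] using abs_coe_le_norm (Y - Z) k
  refine (norm_le (by positivity)).2 fun n => ?_
  simp only [BoundedContinuousFunction.coe_sub, Pi.sub_apply, coe_ofNormedAddCommGroupDiscrete,
    Real.norm_eq_abs]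
  have a1 := abs_coe_le_norm Y (n - 1); have a3 := abs_coe_le_norm Y (n + 1)
  have b1 := abs_coe_le_norm Z (n - 1); have b2 := abs_coe_le_norm Z n
  have d1 := hd (n - 1); have d2 := hd n; have d3 := hd (n + 1)
  have hdn := norm_nonneg (Y - Z)
  have e1 : |Λ * Y (n - 1) ^ 2 - Λ * Z (n - 1) ^ 2| ≤ Λ * (‖Y - Z‖ * (ρ + ρ)) := by
    have : Λ * Y (n - 1) ^ 2 - Λ * Z (n - 1) ^ 2
        = Λ * ((Y (n - 1) - Z (n - 1)) * (Y (n - 1) + Z (n - 1))) := by ring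
    rw [this, abs_mul, abs_of_pos hΛ, abs_mul]
    refine mul_le_mul_of_nonneg_left ?_ hΛ.le
    exact mul_le_mul d1 ((abs_add_le _ _).trans (add_le_add (a1.trans hY) (b1.trans hZ)))
      (abs_nonneg _) hdn
  have e2 : |Λ⁻¹ * Y n * Y (n + 1) - Λ⁻¹ * Z n * Z (n + 1)|
      ≤ Λ⁻¹ * (‖Y - Z‖ * ρ + ρ * ‖Y - Z‖) := by
    have : Λ⁻¹ * Y n * Y (n + 1) - Λ⁻¹ * Z n * Z (n + 1)
        = Λ⁻¹ * ((Y n - Z n) * Y (n + 1) + Z n * (Y (n + 1) - Z (n + 1))) := by ring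
    rw [this, abs_mul, abs_of_pos hΛi]
    refine mul_le_mul_of_nonneg_left ?_ hΛi.le
    refine (abs_add_le _ _).trans (add_le_add ?_ ?_)
    · rw [abs_mul]; exact mul_le_mul d2 (a3.trans hY) (abs_nonneg _) hdn
    · rw [abs_mul]; exact mul_le_mul (b2.trans hZ) d3 (abs_nonneg _) hρ
  have : Λ * Y (n - 1) ^ 2 - Λ⁻¹ * Y n * Y (n + 1) - (Λ * Z (n - 1) ^ 2 - Λ⁻¹ * Z n * Z (n + 1))
      = (Λ * Y (n - 1) ^ 2 - Λ * Z (n - 1) ^ 2)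
        - (Λ⁻¹ * Y n * Y (n + 1) - Λ⁻¹ * Z n * Z (n + 1)) := by ring
  rw [this]
  calc |Λ * Y (n - 1) ^ 2 - Λ * Z (n - 1) ^ 2 - (Λ⁻¹ * Y n * Y (n + 1) - Λ⁻¹ * Z n * Z (n + 1))|
      ≤ |Λ * Y (n - 1) ^ 2 - Λ * Z (n - 1) ^ 2|
        + |Λ⁻¹ * Y n * Y (n + 1) - Λ⁻¹ * Z n * Z (n + 1)| := abs_sub _ _
    _ ≤ Λ * (‖Y - Z‖ * (ρ + ρ)) + Λ⁻¹ * (‖Y - Z‖ * ρ + ρ * ‖Y - Z‖) := add_le_add e1 e2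
    _ = 2 * (Λ + Λ⁻¹) * ρ * ‖Y - Z‖ := by ring

/-! ## Norm-differentiability from coordinatewise differentiability with a uniform modulus -/

/-- **Coordinatewise ⇒ norm differentiability in `ℓ^∞(ℤ)`.**  Let `f : ℝ → (ℤ →ᵇ ℝ)` and
`D : ℝ → (ℤ →ᵇ ℝ)`.  If on a neighbourhood `(t − r, t + r)` every coordinate `s ↦ f s n` has
derivative `D s n`, and the coordinate derivatives obey `|D τ n − D t n| ≤ M|τ − t|` uniformly in `n`,
then `f` is differentiable at `t` in norm with derivative `D t` (the remainder is `≤ M|τ − t|²`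
coordinatewise by the mean value inequality, hence in norm).
[folklore] -/
theorem hasDerivAt_of_coord {f D : ℝ → ℤ →ᵇ ℝ} {t r M : ℝ} (hr : 0 < r) (hM : 0 ≤ M)
    (hcoord : ∀ n : ℤ, ∀ τ ∈ Ioo (t - r) (t + r), HasDerivAt (fun s => f s n) (D τ n) τ)
    (hlip : ∀ n : ℤ, ∀ τ ∈ Ioo (t - r) (t + r), |D τ n - D t n| ≤ M * |τ - t|) :
    HasDerivAt f (D t) t := by
  rw [hasDerivAt_iff_isLittleO]
  -- the remainder is `O(|τ - t|²)`
  have hbound : ∀ τ ∈ Ioo (t - r) (t + r), ‖f τ - f t - (τ - t) • D t‖ ≤ M * ‖τ - t‖ ^ 2 := by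
    intro τ hτ
    have hseg : uIcc t τ ⊆ Ioo (t - r) (t + r) := by
      rcases le_total t τ with h | h
      · rw [uIcc_of_le h]; exact fun u hu => ⟨by linarith [hu.1], lt_of_le_of_lt hu.2 hτ.2⟩
      · rw [uIcc_of_ge h]; exact fun u hu => ⟨lt_of_lt_of_le hτ.1 hu.1, by linarith [hu.2]⟩
    refine (norm_le (by positivity)).2 fun n => ?_
    simp only [BoundedContinuousFunction.coe_sub, BoundedContinuousFunction.coe_smul, Pi.sub_apply,
      smul_eq_mul, Real.norm_eq_abs]
    -- `g u = f u n - u * D t n` has derivative `D u n - D t n`, bounded by `M|τ - t|` on the segment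
    have hg : ∀ u ∈ uIcc t τ, HasDerivWithinAt (fun u => f u n - u * D t n) (D u n - D t n)
        (uIcc t τ) u := by
      intro u hu
      have h1 := hcoord n u (hseg hu)
      have h2 : HasDerivAt (fun u : ℝ => u * D t n) (D t n) u := by
        simpa using (hasDerivAt_id u).mul_const (D t n)
      exact (h1.sub h2).hasDerivWithinAt
    have hgb : ∀ u ∈ uIcc t τ, ‖D u n - D t n‖ ≤ M * |τ - t| := by
      intro u hu
      rw [Real.norm_eq_abs]
      refine (hlip n u (hseg hu)).trans (mul_le_mul_of_nonneg_left ?_ hM)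
      exact abs_sub_left_of_mem_uIcc hu
    have hmv := (convex_uIcc t τ).norm_image_sub_le_of_norm_hasDerivWithin_le hg hgb
      (left_mem_uIcc) (right_mem_uIcc)
    rw [Real.norm_eq_abs, Real.norm_eq_abs] at hmv
    have hid : f τ n - f t n - (τ - t) * D t n = (f τ n - τ * D t n) - (f t n - t * D t n) := by ring
    rw [hid, sq]
    calc |f τ n - τ * D t n - (f t n - t * D t n)| ≤ M * |τ - t| * |τ - t| := hmv
      _ = M * (|τ - t| * |τ - t|) := by ring
  have hO : (fun τ => f τ - f t - (τ - t) • D t) =O[𝓝 t] fun τ => ‖τ - t‖ ^ 2 := by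
    refine IsBigO.of_bound M ?_
    filter_upwards [Ioo_mem_nhds (show t - r < t by linarith) (show t < t + r by linarith)] with τ hτ
    rw [Real.norm_of_nonneg (by positivity)]
    exact hbound τ hτ
  exact hO.trans_isLittleO (isLittleO_pow_sub_sub t one_lt_two)


/-! ## Regular coordinatewise solutions are integral curves in `ℓ^∞(ℤ)` -/

section Curve

variable {Λ a T B : ℝ} {X : ℤ → ℝ → ℝ}

/-- **A regular solution is Lipschitz in time, uniformly in the shell**: if `X` solves the dyadic
law on `(a, T)` at every shell with `Λⁿ|Xₙ| ≤ B` there, then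
`|ΛⁿXₙ(τ) − ΛⁿXₙ(t)| ≤ (Λ+Λ⁻¹)B²|τ − t|` for `τ, t ∈ (a, T)`.
[cite: Tao2016AveragedNS, §1.2, §4 Lemma 4.1 (4.8) with `m = 1`; elementary] -/
theorem dyadic_regular_lipschitz (hΛ : 0 < Λ)
    (hlaw : ∀ n : ℤ, ∀ t ∈ Ioo a T,
      HasDerivAt (X n) (Λ ^ (n - 1) * X (n - 1) t ^ 2 - Λ ^ n * X n t * X (n + 1) t) t)
    (hreg : ∀ n : ℤ, ∀ t ∈ Ioo a T, |Λ ^ n * X n t| ≤ B)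
    (n : ℤ) {τ t : ℝ} (hτ : τ ∈ Ioo a T) (ht : t ∈ Ioo a T) :
    |Λ ^ n * X n τ - Λ ^ n * X n t| ≤ (Λ + Λ⁻¹) * B ^ 2 * |τ - t| := by
  have hΛne : Λ ≠ 0 := hΛ.ne'
  have hΛi : 0 < Λ⁻¹ := inv_pos.2 hΛ
  have hB : 0 ≤ B := (abs_nonneg _).trans (hreg n t ht)
  have hseg : uIcc t τ ⊆ Ioo a T := by
    rcases le_total t τ with h | h
    · rw [uIcc_of_le h]; exact fun u hu => ⟨ht.1.trans_le hu.1, lt_of_le_of_lt hu.2 hτ.2⟩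
    · rw [uIcc_of_ge h]; exact fun u hu => ⟨hτ.1.trans_le hu.1, lt_of_le_of_lt hu.2 ht.2⟩
  -- the conjugated derivative `Λⁿ Ẋₙ = Λ Yₙ₋₁² − Λ⁻¹ Yₙ Yₙ₊₁`, bounded by `(Λ+Λ⁻¹)B²`
  have hder : ∀ u ∈ uIcc t τ, HasDerivWithinAt (fun s => Λ ^ n * X n s)
      (Λ * (Λ ^ (n - 1) * X (n - 1) u) ^ 2
        - Λ⁻¹ * (Λ ^ n * X n u) * (Λ ^ (n + 1) * X (n + 1) u)) (uIcc t τ) u := by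
    intro u hu
    refine (((hlaw n u (hseg hu)).const_mul (Λ ^ n)).congr_deriv ?_).hasDerivWithinAt
    rw [zpow_sub_one₀ hΛne, zpow_add_one₀ hΛne]
    field_simp
  have hbd : ∀ u ∈ uIcc t τ, ‖Λ * (Λ ^ (n - 1) * X (n - 1) u) ^ 2
      - Λ⁻¹ * (Λ ^ n * X n u) * (Λ ^ (n + 1) * X (n + 1) u)‖ ≤ (Λ + Λ⁻¹) * B ^ 2 := by
    intro u hu
    have hu' := hseg hu
    have h1 := hreg (n - 1) u hu'
    have h2 := hreg n u hu'
    have h3 := hreg (n + 1) u hu'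
    rw [Real.norm_eq_abs]
    have e1 : |Λ * (Λ ^ (n - 1) * X (n - 1) u) ^ 2| ≤ Λ * B ^ 2 := by
      rw [abs_mul, abs_of_pos hΛ, abs_pow]
      exact mul_le_mul_of_nonneg_left (pow_le_pow_left₀ (abs_nonneg _) h1 2) hΛ.le
    have e2 : |Λ⁻¹ * (Λ ^ n * X n u) * (Λ ^ (n + 1) * X (n + 1) u)| ≤ Λ⁻¹ * B ^ 2 := by
      rw [abs_mul, abs_mul, abs_of_pos hΛi, mul_assoc, sq]
      exact mul_le_mul_of_nonneg_left (mul_le_mul h2 h3 (abs_nonneg _) hB) hΛi.le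
    calc |Λ * (Λ ^ (n - 1) * X (n - 1) u) ^ 2 - Λ⁻¹ * (Λ ^ n * X n u) * (Λ ^ (n + 1) * X (n + 1) u)|
        ≤ |Λ * (Λ ^ (n - 1) * X (n - 1) u) ^ 2|
          + |Λ⁻¹ * (Λ ^ n * X n u) * (Λ ^ (n + 1) * X (n + 1) u)| := abs_sub _ _
      _ ≤ Λ * B ^ 2 + Λ⁻¹ * B ^ 2 := add_le_add e1 e2
      _ = (Λ + Λ⁻¹) * B ^ 2 := by ring
  have h := (convex_uIcc t τ).norm_image_sub_le_of_norm_hasDerivWithin_le hder hbd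
    left_mem_uIcc right_mem_uIcc
  rwa [Real.norm_eq_abs, Real.norm_eq_abs] at h

/-- **A regular coordinatewise solution is an integral curve in `ℓ^∞(ℤ)`.**  Let `X` solve the
dyadic law on `(a, T)` at every shell with `Λⁿ|Xₙ| ≤ B` there, and let `f : ℝ → (ℤ →ᵇ ℝ)` be ANY
curve whose coordinates on `(a, T)` are `f t n = ΛⁿXₙ(t)`.  Then at every `t ∈ (a, T)` the curve `f`
is differentiable IN NORM, with derivative the conjugated field `(ΛYₙ₋₁² − Λ⁻¹YₙYₙ₊₁)ₙ` at `Y = f t`,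
and `‖f t‖ ≤ B`.
[cite: Tao2016AveragedNS, §1.2, §4 Lemma 4.1 (4.8) with `m = 1`; elementary (uniform-in-shell time-Lipschitz bound + mean value inequality)] -/
theorem dyadic_integralCurve (hΛ : 0 < Λ)
    (hlaw : ∀ n : ℤ, ∀ t ∈ Ioo a T,
      HasDerivAt (X n) (Λ ^ (n - 1) * X (n - 1) t ^ 2 - Λ ^ n * X n t * X (n + 1) t) t)
    (hreg : ∀ n : ℤ, ∀ t ∈ Ioo a T, |Λ ^ n * X n t| ≤ B)
    {f : ℝ → ℤ →ᵇ ℝ} (hf : ∀ t ∈ Ioo a T, ∀ n : ℤ, f t n = Λ ^ n * X n t)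
    {t : ℝ} (ht : t ∈ Ioo a T) :
    HasDerivAt f (ofNormedAddCommGroupDiscrete
        (fun n => Λ * f t (n - 1) ^ 2 - Λ⁻¹ * f t n * f t (n + 1))
        ((Λ + Λ⁻¹) * ‖f t‖ ^ 2) (conjField_bound hΛ (f t))) t ∧ ‖f t‖ ≤ B := by
  have hΛne : Λ ≠ 0 := hΛ.ne'
  have hB : 0 ≤ B := (abs_nonneg _).trans (hreg 0 t ht)
  set C : ℝ := Λ + Λ⁻¹ with hC
  have hC0 : 0 < C := by positivity
  -- norm bound of the curve on the interval
  have hfn : ∀ τ ∈ Ioo a T, ‖f τ‖ ≤ B := fun τ hτ =>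
    (norm_le hB).2 fun n => by rw [Real.norm_eq_abs, hf τ hτ n]; exact hreg n τ hτ
  refine ⟨?_, hfn t ht⟩
  -- the field along the curve
  set D : ℝ → ℤ →ᵇ ℝ := fun τ => ofNormedAddCommGroupDiscrete
      (fun n => Λ * f τ (n - 1) ^ 2 - Λ⁻¹ * f τ n * f τ (n + 1))
      ((Λ + Λ⁻¹) * ‖f τ‖ ^ 2) (conjField_bound hΛ (f τ)) with hD
  have hDapply : ∀ τ n, D τ n = Λ * f τ (n - 1) ^ 2 - Λ⁻¹ * f τ n * f τ (n + 1) := fun τ n => rfl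
  -- a symmetric neighbourhood of `t` inside `(a, T)`
  set r : ℝ := min (t - a) (T - t) with hr
  have hr0 : 0 < r := lt_min (by linarith [ht.1]) (by linarith [ht.2])
  have hsub : Ioo (t - r) (t + r) ⊆ Ioo a T := fun u hu =>
    ⟨by linarith [hu.1, min_le_left (t - a) (T - t)], by linarith [hu.2, min_le_right (t - a) (T - t)]⟩
  -- coordinatewise derivatives
  have hcoord : ∀ n : ℤ, ∀ τ ∈ Ioo (t - r) (t + r), HasDerivAt (fun s => f s n) (D τ n) τ := by
    intro n τ hτ
    have hτ' := hsub hτ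
    have hev : (fun s => f s n) =ᶠ[𝓝 τ] fun s => Λ ^ n * X n s := by
      filter_upwards [Ioo_mem_nhds hτ'.1 hτ'.2] with s hs using hf s hs n
    refine HasDerivAt.congr_of_eventuallyEq ?_ hev
    refine ((hlaw n τ hτ').const_mul (Λ ^ n)).congr_deriv ?_
    rw [hDapply, hf τ hτ' (n - 1), hf τ hτ' n, hf τ hτ' (n + 1), zpow_sub_one₀ hΛne,
      zpow_add_one₀ hΛne]
    field_simp
  -- the coordinate derivatives are Lipschitz in time, uniformly in the shell
  have hflip : ∀ τ ∈ Ioo a T, ‖f τ - f t‖ ≤ C * B ^ 2 * |τ - t| := by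
    intro τ hτ
    refine (norm_le (by positivity)).2 fun n => ?_
    rw [BoundedContinuousFunction.coe_sub, Pi.sub_apply, Real.norm_eq_abs, hf τ hτ n, hf t ht n]
    exact dyadic_regular_lipschitz hΛ hlaw hreg n hτ ht
  have hFlip := conjField_lipschitz hΛ hB
  have hlip : ∀ n : ℤ, ∀ τ ∈ Ioo (t - r) (t + r),
      |D τ n - D t n| ≤ 2 * C * B * (C * B ^ 2) * |τ - t| := by
    intro n τ hτ
    have hτ' := hsub hτ
    have h1 : |D τ n - D t n| ≤ ‖D τ - D t‖ := by
      simpa only [BoundedContinuousFunction.coe_sub, Pi.sub_apply] using abs_coe_le_norm (D τ - D t) n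
    have hmemτ : f τ ∈ closedBall (0 : ℤ →ᵇ ℝ) B := by
      rw [mem_closedBall, dist_zero_right]; exact hfn τ hτ'
    have hmemt : f t ∈ closedBall (0 : ℤ →ᵇ ℝ) B := by
      rw [mem_closedBall, dist_zero_right]; exact hfn t ht
    have h2 := hFlip.dist_le_mul (f τ) hmemτ (f t) hmemt
    rw [dist_eq_norm, dist_eq_norm, Real.coe_toNNReal _ (by positivity)] at h2
    have h3 := hflip τ hτ'
    calc |D τ n - D t n| ≤ ‖D τ - D t‖ := h1
      _ ≤ 2 * (Λ + Λ⁻¹) * B * ‖f τ - f t‖ := h2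
      _ ≤ 2 * (Λ + Λ⁻¹) * B * (C * B ^ 2 * |τ - t|) :=
          mul_le_mul_of_nonneg_left h3 (by positivity)
      _ = 2 * C * B * (C * B ^ 2) * |τ - t| := by rw [hC]; ring
  exact hasDerivAt_of_coord hr0 (by positivity) hcoord hlip

/-- **UNIQUENESS OF REGULAR SOLUTIONS.**  Two solutions `X, X'` of the dyadic lattice on `(a, T)`
(every shell), both regular (`Λⁿ|Xₙ| ≤ B`, `Λⁿ|X'ₙ| ≤ B'` on `(a, T)`), which agree at one instant
`t₀ ∈ (a, T)`, agree on all of `(a, T)`.  (Both are integral curves of the conjugated field in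
`ℓ^∞(ℤ)`, which is Lipschitz on the ball of radius `max B B'`; Mathlib's Gronwall uniqueness
`ODE_solution_unique_of_mem_Ioo`.)
[cite: Tao2016AveragedNS, §1.2, §4 Lemma 4.1 (4.8) with `m = 1`; Teschl2012 Thm. 2.2 (uniqueness half)] -/
theorem dyadic_unique (hΛ : 0 < Λ) {X' : ℤ → ℝ → ℝ} {B' : ℝ}
    (hlaw : ∀ n : ℤ, ∀ t ∈ Ioo a T,
      HasDerivAt (X n) (Λ ^ (n - 1) * X (n - 1) t ^ 2 - Λ ^ n * X n t * X (n + 1) t) t)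
    (hreg : ∀ n : ℤ, ∀ t ∈ Ioo a T, |Λ ^ n * X n t| ≤ B)
    (hlaw' : ∀ n : ℤ, ∀ t ∈ Ioo a T,
      HasDerivAt (X' n) (Λ ^ (n - 1) * X' (n - 1) t ^ 2 - Λ ^ n * X' n t * X' (n + 1) t) t)
    (hreg' : ∀ n : ℤ, ∀ t ∈ Ioo a T, |Λ ^ n * X' n t| ≤ B')
    {t₀ : ℝ} (ht₀ : t₀ ∈ Ioo a T) (h0 : ∀ n : ℤ, X n t₀ = X' n t₀) :
    ∀ n : ℤ, ∀ t ∈ Ioo a T, X n t = X' n t := by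
  have hΛne : Λ ≠ 0 := hΛ.ne'
  set M : ℝ := max B B' with hM
  have hB : 0 ≤ B := (abs_nonneg _).trans (hreg 0 t₀ ht₀)
  have hM0 : 0 ≤ M := hB.trans (le_max_left _ _)
  have hregM : ∀ n : ℤ, ∀ t ∈ Ioo a T, |Λ ^ n * X n t| ≤ M := fun n t ht =>
    (hreg n t ht).trans (le_max_left _ _)
  have hregM' : ∀ n : ℤ, ∀ t ∈ Ioo a T, |Λ ^ n * X' n t| ≤ M := fun n t ht =>
    (hreg' n t ht).trans (le_max_right _ _)
  -- the clamp `max (-M) (min M x)` (tree: `Literature.Analysis.FunctionSpaces.max_neg_min_eq_self`)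
  have abs_clamp_le : ∀ x : ℝ, |max (-M) (min M x)| ≤ M := fun x =>
    abs_le.2 ⟨le_max_left _ _, max_le (by linarith) (min_le_left _ _)⟩
  have clamp_eq : ∀ x : ℝ, |x| ≤ M → max (-M) (min M x) = x := fun x h => by
    obtain ⟨h1, h2⟩ := abs_le.1 h
    rw [min_eq_right h2, max_eq_right h1]
  -- the clamped conjugated curves
  set f : ℝ → ℤ →ᵇ ℝ := fun t => ofNormedAddCommGroupDiscrete
      (fun n => max (-M) (min M (Λ ^ n * X n t))) M
      (fun n => by rw [Real.norm_eq_abs]; exact abs_clamp_le _) with hfdef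
  set g : ℝ → ℤ →ᵇ ℝ := fun t => ofNormedAddCommGroupDiscrete
      (fun n => max (-M) (min M (Λ ^ n * X' n t))) M
      (fun n => by rw [Real.norm_eq_abs]; exact abs_clamp_le _) with hgdef
  have hf : ∀ t ∈ Ioo a T, ∀ n : ℤ, f t n = Λ ^ n * X n t := fun t ht n => by
    simp only [hfdef, coe_ofNormedAddCommGroupDiscrete]; exact clamp_eq _ (hregM n t ht)
  have hg : ∀ t ∈ Ioo a T, ∀ n : ℤ, g t n = Λ ^ n * X' n t := fun t ht n => by
    simp only [hgdef, coe_ofNormedAddCommGroupDiscrete]; exact clamp_eq _ (hregM' n t ht)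
  -- the (time-independent) conjugated field and its Lipschitz bound on the ball of radius `M`
  set v : ℝ → (ℤ →ᵇ ℝ) → (ℤ →ᵇ ℝ) := fun _ Y => ofNormedAddCommGroupDiscrete
      (fun n => Λ * Y (n - 1) ^ 2 - Λ⁻¹ * Y n * Y (n + 1)) ((Λ + Λ⁻¹) * ‖Y‖ ^ 2)
      (conjField_bound hΛ Y) with hvdef
  have hv : ∀ t ∈ Ioo a T, LipschitzOnWith (Real.toNNReal (2 * (Λ + Λ⁻¹) * M)) (v t)
      (closedBall (0 : ℤ →ᵇ ℝ) M) := fun t _ => conjField_lipschitz hΛ hM0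
  have hfc : ∀ t ∈ Ioo a T, HasDerivAt f (v t (f t)) t ∧ f t ∈ closedBall (0 : ℤ →ᵇ ℝ) M := by
    intro t ht
    obtain ⟨h1, h2⟩ := dyadic_integralCurve hΛ hlaw hregM hf ht
    exact ⟨h1, by rw [mem_closedBall, dist_zero_right]; exact h2⟩
  have hgc : ∀ t ∈ Ioo a T, HasDerivAt g (v t (g t)) t ∧ g t ∈ closedBall (0 : ℤ →ᵇ ℝ) M := by
    intro t ht
    obtain ⟨h1, h2⟩ := dyadic_integralCurve hΛ hlaw' hregM' hg ht
    exact ⟨h1, by rw [mem_closedBall, dist_zero_right]; exact h2⟩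
  have heq : f t₀ = g t₀ := by
    ext n
    rw [hf t₀ ht₀ n, hg t₀ ht₀ n, h0 n]
  have hE := ODE_solution_unique_of_mem_Ioo hv ht₀ hfc hgc heq
  intro n t ht
  have h : f t n = g t n := by rw [hE ht]
  rw [hf t ht n, hg t ht n] at h
  exact mul_left_cancel₀ (zpow_ne_zero n hΛne) h

end Curve

end WakeRatchetDyadicCauchy

end Summit.NavierStokesRegularity.NavierStokesRegularity.Theorems

end
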